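import Literature.AlgebraicGeometry.Motives.AbelianVarietyGoodReductionHomConjFrob
import Literature.AlgebraicGeometry.Motives.AbelianSchemeModelTateSpecialisationFamily
import HarnessLib

/-!
# The Frobenius-conjugate companions of the NAMED produced datum `IsAbelianSchemeModel.goodReductionAt`

Topic `Literature/AlgebraicGeometry/Motives`; sequel of `AbelianVarietyGoodReductionHomConjFrob` (FactRH′ companions edition:
`HomReduction`s into / out of the Frobenius-conjugate datum, for PRODUCED data) and of
`AbelianSchemeModelTateSpecialisationFamily` (the produced datum NAMED: `h.goodReductionAt`, `h.homReduction h'`,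
`h.tateSpecialisation ℓ hℓv`); cell `hodgecm-mathlib` (D-0151), programme E4 (S5c′), the «companions data accessor» of the
E4 assembly map (B-p20, `B-provers/B-p20/E4-S5cPrime-ASSEMBLY-MAP.md`, row `Hγ i`, `Hγ′ i`).

For abelian-scheme models `𝒜ᵢ` of `Aᵢ` and `𝒜ₐ` of `Aₐ` at `v` and an arithmetic Frobenius `γ ∈ Aut(K/F₀)` at `v` (`q = pⁿ`):
the two reduction-of-homomorphisms data between the named produced datum `hᵢ.goodReductionAt` and the Frobenius-conjugate
datum `hₐ.goodReductionAt.conjFrob γ hγ p n hq` of `Aₐ^γ` (model `𝒜ₐ ⊗_{γᵥ} 𝓞_v`, reduction `(𝒜ₐ)_v^{(q)}` — [Shimura1998] §18.6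
p. 127 «`(Y^σ)~ = Ỹ^f`»; §11.1 Prop. 12) EXIST (`nonempty_homReduction_conjFrob`, `…_conjFrob'` — the Néron mapping property
of the proper smooth target model, `HomReduction.nonempty_of_mappingProperty`, with the conjugate model's group package
`conjOfSquares_grpPackage`) and are NAMED by choice (`homReductionConjFrob`, `homReductionConjFrob'`; their `liftHom` is the
Néron lift and their `redHom` its special fibre by the structure's own pins — `AbelianVarietyGoodReductionHomPins`).
THEOREMS + two `Classical.choice` DATA definitions (no named fact, no instance; net Literature debt 0).
HC_CM is proved only modulo the 7 printed citations until rung 0 closes.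
-/

set_option autoImplicit false

noncomputable section

open CategoryTheory CategoryTheory.Limits AlgebraicGeometry IsDedekindDomain IsDedekindDomain.HeightOneSpectrum
open scoped NumberField CategoryTheory.Obj
open Literature.NumberTheory.EllipticCurves (genericFibre specGenericPoint IsNeronModel isNeronModel_of_isProper_of_smooth)
open Literature.AlgebraicGeometry.Motives (AbelianVariety SchemeOver algEquivValuationSubring smul_asIdeal_eq_of_isArithFrobAt
  algebraMap_comp_algEquivValuationSubring residueAt_comp_algEquivValuationSubring)
open Literature.AlgebraicGeometry.Motives.AbelianVariety (GoodReductionAt)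
open Literature.AlgebraicGeometry.Motives.AbelianVariety.GoodReductionAt (conjOfSquares_grpPackage)

namespace Literature.NumberTheory.DiophantineGeometry

namespace IsAbelianSchemeModel

variable {F₀ K : Type} [Field F₀] [Field K] [NumberField K] [Algebra F₀ K] {v : HeightOneSpectrum (𝓞 K)}
  {Aᵢ Aₐ : AbelianVariety K} {𝒜ᵢ 𝒜ₐ : SchemeOver (valuationSubringAtPrime K v)} [GrpObj 𝒜ᵢ] [GrpObj 𝒜ₐ]

/-- The generic-fibre identification `e_𝒜 = h.exists_iso.choose` of the named produced datum is a group isomorphism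
(in the explicit-instance currency of `HomReduction.nonempty_of_mappingProperty`). [cite: SerreTate1968GoodReduction, §1] -/
theorem isMonHom_goodReductionAt_genericIso (h : IsAbelianSchemeModel Aᵢ v 𝒜ᵢ) :
    @IsMonHom _ _ _ _ _
      (Functor.monObjObj (F := genericFibre (valuationSubringAtPrime K v) K) (X := h.goodReductionAt.model.total)) _
      h.goodReductionAt.model.genericIso.hom :=
  h.exists_iso.choose_spec

/-- The special-fibre identification of the named produced datum is the identity, a group isomorphism.
[cite: SerreTate1968GoodReduction, §1] -/
theorem isMonHom_goodReductionAt_reductionIso (h : IsAbelianSchemeModel Aᵢ v 𝒜ᵢ) :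
    @IsMonHom _ _ _ _ _ _ (Functor.monObjObj (F := specialFibreFunctor v) (X := h.goodReductionAt.model.total))
      h.goodReductionAt.reductionIso.hom := by
  change IsMonHom (𝟙 ((specialFibreFunctor v).obj 𝒜ᵢ))
  infer_instance

/-- **`HomReduction (𝒜ᵢ-datum) ((𝒜ₐ-datum)^γ)` and its reverse EXIST for the named produced data** ([Shimura1998] §11.1
Prop. 12, §18.6 p. 127): Néron mapping property of the proper smooth conjugate model `𝒜ₐ ⊗_{γᵥ} 𝓞_v` (resp. of `𝒜ᵢ`) at the
smooth source, with the conjugate model's transported group structure and group-scheme identifications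
(`conjOfSquares_grpPackage`); the pair constructor is `HomReduction.nonempty_of_mappingProperty`.
[cite: Shimura1998, §11.1 Prop. 12 (p. 83) and §18.6 proof of Thm. 18.6 (reduction modulo `𝔓`, «(Y^σ)~ = Ỹ^f»), p. 127] [cite: BLRNeronModels1990, Prop. 1.2/8] -/
theorem nonempty_homReduction_conjFrob (hi : IsAbelianSchemeModel Aᵢ v 𝒜ᵢ) (ha : IsAbelianSchemeModel Aₐ v 𝒜ₐ)
    (γ : K ≃ₐ[F₀] K) (hγ : IsArithFrobAt (𝓞 F₀) γ v.asIdeal) (p n : ℕ) [ExpChar v.asIdeal.ResidueField p]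
    (hq : Nat.card (𝓞 F₀ ⧸ v.asIdeal.under (𝓞 F₀)) = p ^ n) :
    Nonempty (GoodReductionAt.HomReduction hi.goodReductionAt (ha.goodReductionAt.conjFrob γ hγ p n hq)) ∧
      Nonempty (GoodReductionAt.HomReduction (ha.goodReductionAt.conjFrob γ hγ p n hq) hi.goodReductionAt) := by
  -- instances of the two produced models
  haveI := hi.isProper
  haveI := ha.isProper
  haveI := hi.smooth
  haveI := ha.smooth
  haveI : Smooth 𝒜ᵢ.hom := SmoothOfRelativeDimension.smooth Aᵢ.dim 𝒜ᵢ.hom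
  haveI : Smooth 𝒜ₐ.hom := SmoothOfRelativeDimension.smooth Aₐ.dim 𝒜ₐ.hom
  haveI : Smooth hi.goodReductionAt.model.total.hom := ‹Smooth 𝒜ᵢ.hom›
  haveI : IsProper hi.goodReductionAt.model.total.hom := ‹IsProper 𝒜ᵢ.hom›
  haveI : Smooth ha.goodReductionAt.model.total.hom := ‹Smooth 𝒜ₐ.hom›
  haveI : IsProper ha.goodReductionAt.model.total.hom := ‹IsProper 𝒜ₐ.hom›
  -- the conjugate datum's group package
  obtain ⟨instC, hsmC, hprC, hgenC, hredC⟩ := conjOfSquares_grpPackage ha.goodReductionAt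
    ha.isMonHom_goodReductionAt_genericIso ha.isMonHom_goodReductionAt_reductionIso γ.toRingEquiv
    (algEquivValuationSubring v γ (smul_asIdeal_eq_of_isArithFrobAt v γ hγ))
    (algebraMap_comp_algEquivValuationSubring v γ _) p n (residueAt_comp_algEquivValuationSubring v γ hγ p n hq)
  letI : GrpObj (ha.goodReductionAt.conjFrob γ hγ p n hq).model.total := instC
  haveI : Smooth (ha.goodReductionAt.conjFrob γ hγ p n hq).model.total.hom := hsmC
  haveI : IsProper (ha.goodReductionAt.conjFrob γ hγ p n hq).model.total.hom := hprC
  exact ⟨GoodReductionAt.HomReduction.nonempty_of_mappingProperty hi.goodReductionAt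
      (ha.goodReductionAt.conjFrob γ hγ p n hq) hi.isMonHom_goodReductionAt_genericIso hgenC
      hi.isMonHom_goodReductionAt_reductionIso hredC
      ((isNeronModel_of_isProper_of_smooth _ K (ha.goodReductionAt.conjFrob γ hγ p n hq).model.total).mappingProperty
        hi.goodReductionAt.model.total inferInstance),
    GoodReductionAt.HomReduction.nonempty_of_mappingProperty (ha.goodReductionAt.conjFrob γ hγ p n hq)
      hi.goodReductionAt hgenC hi.isMonHom_goodReductionAt_genericIso hredC hi.isMonHom_goodReductionAt_reductionIso
      ((isNeronModel_of_isProper_of_smooth _ K hi.goodReductionAt.model.total).mappingProperty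
        (ha.goodReductionAt.conjFrob γ hγ p n hq).model.total inferInstance)⟩

/-- **The companion `HomReduction (𝒜ᵢ-datum) ((𝒜ₐ-datum)^γ)`, NAMED** (a choice; its `liftHom` is the Néron lift and its
`redHom` the special fibre of the lift, by the structure's pins — any two choices agree on `liftHom`,
`HomReduction.liftHom_eq_of_map_eq`). [cite: Shimura1998, §11.1 Prop. 12 (p. 83) and §18.6 proof of Thm. 18.6 (reduction modulo `𝔓`, «(Y^σ)~ = Ỹ^f»), p. 127] -/
def homReductionConjFrob (hi : IsAbelianSchemeModel Aᵢ v 𝒜ᵢ) (ha : IsAbelianSchemeModel Aₐ v 𝒜ₐ)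
    (γ : K ≃ₐ[F₀] K) (hγ : IsArithFrobAt (𝓞 F₀) γ v.asIdeal) (p n : ℕ) [ExpChar v.asIdeal.ResidueField p]
    (hq : Nat.card (𝓞 F₀ ⧸ v.asIdeal.under (𝓞 F₀)) = p ^ n) :
    GoodReductionAt.HomReduction hi.goodReductionAt (ha.goodReductionAt.conjFrob γ hγ p n hq) :=
  Classical.choice (hi.nonempty_homReduction_conjFrob ha γ hγ p n hq).1

/-- **The reverse companion `HomReduction ((𝒜ₐ-datum)^γ) (𝒜ᵢ-datum)`, NAMED** (a choice, pinned as above).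
[cite: Shimura1998, §11.1 Prop. 12 (p. 83) and §18.6 proof of Thm. 18.6 (reduction modulo `𝔓`, «(Y^σ)~ = Ỹ^f»), p. 127] -/
def homReductionConjFrob' (hi : IsAbelianSchemeModel Aᵢ v 𝒜ᵢ) (ha : IsAbelianSchemeModel Aₐ v 𝒜ₐ)
    (γ : K ≃ₐ[F₀] K) (hγ : IsArithFrobAt (𝓞 F₀) γ v.asIdeal) (p n : ℕ) [ExpChar v.asIdeal.ResidueField p]
    (hq : Nat.card (𝓞 F₀ ⧸ v.asIdeal.under (𝓞 F₀)) = p ^ n) :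
    GoodReductionAt.HomReduction (ha.goodReductionAt.conjFrob γ hγ p n hq) hi.goodReductionAt :=
  Classical.choice (hi.nonempty_homReduction_conjFrob ha γ hγ p n hq).2

end IsAbelianSchemeModel

end Literature.NumberTheory.DiophantineGeometry

end
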